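import Literature.MathematicalPhysics.QuantumFieldTheory.Balaban1983to89.B6BlockHolderLipschitzV1
import Literature.MathematicalPhysics.QuantumFieldTheory.Balaban1983to89.B6BlockHolderHjV1
import Literature.MathematicalPhysics.QuantumFieldTheory.Balaban1983to89.B6BlockHolderGEV1
import Literature.MathematicalPhysics.QuantumFieldTheory.Balaban1983to89.B6BlockDecayGradCompositesV1

/-!
# `Balaban1983to89.B6BlockHolderCompositesV1` — T. Bałaban, *Propagators and renormalization transformations for lattice gauge theories. II*,
# Commun. Math. Phys. **96** (1984) 223–250 [Balaban1984PropagatorsII], Prop. 2.5 p. 246, towards the HÖLDER member `‖ζ∇GJ‖_α` of (1.111) for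
# the two-scale `G` of (2.90): the differentiated summands `D_λK₁`, `D_λK₂*`, `D_λ(H_jC̃^{(j)}_ΛH_j*)`, `D_λG̃_j` of (2.129) have exponentially
# decaying PAIR (Hölder-in-the-output) block kernels for `tsV1` at the paper's scaling — file 4 of the Hölder programme (p38), the pair-bound
# twin of p22's `B6BlockDecayGradCompositesV1`

statement-level skeleton of published theorems with citation tags; proofs where landed; nothing here is a claim about the Yang–Mills mass gap

p. 246 (Prop. 2.5): *"… satisfies all the inequalities (1.110)–(1.114) of the Proposition 1.2 with a positive constant δ₂ instead of δ₀."*;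
[4] (1.111) p. 35: *"‖ζ∇GJ‖_α, ‖ζG∇*J‖_α ≤ O(1)e^{−δ₀|y−y′|}(‖ζ‖_α + |ζ|)|J| … for 0 ≤ α < 1, ζ ∈ C₀^∞(Δ̃(y)), supp J ⊂ Δ̃(y′)"*; p. 246:
*"The operators H′_j … their local Hölder norms are uniformly bounded"*, (2.130)–(2.131) for `H_j`, `G̃_j`.

WHAT THIS FILE DOES.  A PAIR BOUND of an operator `f` (fine bonds ← sources `k` at unit positions) at the fine pair `b₁ = ⟨x, ν⟩`, `b₂ = ⟨x′, ν⟩`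
anchored at `y(x)` is `Σ_{k ∈ y}|f(e_k)_{b₁} − f(e_k)_{b₂}| ≤ C_f·e^{−δ|y(x) − y|_T}` (file 1 `B6BlockHolderCalculus`); a pair bound of the FIRST
factor composed with block bounds of the remaining factors is a pair bound of the product (`holderBound_comp`).  With `D_λ = n(S_λ − I)`, at
`c = L^j`, for `|x − x′|_∞ ≤ n`, `t = |x − x′|_∞/n`:
* `D_λK₁ = (D_λ∂H′_j)·[C^{(j)}_Λ(∂H′_j)*]` — pair bound `(C·t, δ)` (`holderBound_DK1_scaling`; first factor LIPSCHITZ in the output, file 2's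
  `holderBound_DgradHp`; tail by p22's files 2, 4);
* `D_λK₂* = (D_λ∂H′_j)·[C^{(j)}_Λ(∂ΔH′_j)*]` — pair bound `(C·t, δ)` (`holderBound_DK2adj_scaling`);
* `D_λ(H_jC̃^{(j)}_ΛH_j*) = (D_λH_j)·[C̃^{(j)}_ΛH_j*]` — pair bound `(C_α·t^α, δ(1−α))` (`holderBound_DHjCtHj_scaling`; first factor file 3's
  `holderBound_DHj`, whose rate `κ_H(1−α)/(1+α)` is `α`-dependent — b05's reading of [4] (1.63), see file 3);
* `D_λG̃_j = D_λG^{(n^{d+1})} − (D_λH_j)·[Q_jG^{(n^{d+1})}]` — pair bound `(C_α·t^α, δ(1−α))` (`holderBound_DGt_scaling`; file 3b's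
  `holderBound_DGE_scaling` = [4] Prop. 1.2 (1.111) BY NAME, p22's `Gt_eq_comp_GE`, `blockBound_Qv`, `blockBound_GE_scaling`).
The rates `δ` do not depend on `α`; the constants `C_α` do (*"O(1) → ∞ if α → 1"*, [4] p. 35).

DICTIONARY / DIVERGENCES as in p22's files 1–10 and files 1–3b of this programme: `α`-dependence of the decay RATE of the two `H_j`-led
summands is b05's HONEST LIMIT (i) propagated (the print claims `δ₂ = δ₂(d, L)`); no new definition, no new hypothesis.  NOT summit progress.
Unit `lit-balaban-p38` (gen 21), 2026-08-22.
-/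

noncomputable section

open scoped InnerProductSpace BigOperators
open Finset

namespace Literature.MathematicalPhysics.QuantumFieldTheory.Balaban1983to89.B6BlockHolderCompositesV1

open LatticeFieldCalculus B5SectBStatements B5Eq117TorusCarriers B6SectADomainsV1 B6SectAOperatorsV1 B6SectAVectorModelV1 B6SectCOperators
  B6SectCTwoScaleV1 B6SectCTwoScaleV1Lattice B5Eq118OneStroke
open BalabanImbrieJaffe1984to88.BIJ85AxialPropagator411 (BondSpace)
open B4Sect5Torus (IsPseudoDist SumBound)
open B4TorusKernel (periodConst)
open B4TorusKernel.MultiPeriod (torusSupNorm torusSupNorm_nonneg)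
open B4Sect5Proof (latticeConst latticeConst_nonneg)
open B5Hk163Decay (MG163 MG163_nonneg)
open B5Hk163Strip (kappaN kappaN_pos kappa163 kappa163_pos)
open B5Hk163TorusHolderDecay (CHD)
open B5Kernel166Decay (periodConst_pos)
open B6LowerBound2153Torus (rep)
open B6Hprime2132Holder (MGHD)
open B6Repr2129Operator (K1_eq adjoint_K2)
open B6BlockDecayCalculus (blockBound_comp torusDist_isPseudoDist torusDist_sumBound)
open B6BlockDecayHjCovV1 (blockBound_Hj_adjoint)
open B6BlockDecayHprimeCovV1 (MGHD_nonneg blockBound_gradHp_adjoint blockBound_gradLapHp_adjoint blockBound_C_of_entry cov_entry_uniform)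
open B6BlockDecayGtV1 (Gt_eq_comp_GE blockBound_GE_scaling blockBound_Qv)
open B6BlockDecayGradFactorsV1 (blockBound_Ct_scaling)
open B6BlockHolderCalculus (holderBound_comp holderBound_sub holderBound_mono)
open B6BlockHolderLipschitzV1 (holderBound_DgradHp)
open B6BlockHolderHjV1 (holderBound_DHj CHD_nonneg)
open B6BlockHolderGEV1 (holderBound_DGE_scaling)

variable {d L m K : ℕ} {hd : 1 ≤ d + 1} {hL : Odd L ∧ 1 < L} {j : ℕ}

/-! ## §1  The two `∂H′_j`-led summands: LIPSCHITZ pair bounds -/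

open Classical in
/-- **`D_λK₁ = (D_λ∂H′_j)C^{(j)}_Λ(∂H′_j)*` HAS AN EXPONENTIALLY DECAYING PAIR KERNEL, UNIFORMLY** (at `c = L^j`): `δ > 0`, `C ≥ 0` depending on
`d, L` only, such that at every fine pair `b₁ = ⟨x, ν⟩`, `b₂ = ⟨x′, ν⟩` with `|x − x′|_∞ ≤ n`,
`Σ_{b₀′ ∈ y}|(D_λK₁)(e_{b₀′})_{b₁} − (D_λK₁)(e_{b₀′})_{b₂}| ≤ C·(|x − x′|_∞/n)·e^{−δ|y(x) − y|_T}` — first factor `D_λ∂H′_j` `((d+1)A₃e^{κ}·t, κ)`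
(file 2), tail `C^{(j)}_Λ(∂H′_j)*` `(E/n^{d+1}·A₁n^{d+1}(d+1)·K, δ₁)` (p22 files 2, 4). [cite: Balaban1984PropagatorsII, Prop. 2.5 p.246;
Balaban1984PropagatorsI, (1.111) p.35] -/
theorem holderBound_DK1_scaling (d L : ℕ) (hd : 1 ≤ d + 1) (hL : Odd L ∧ 1 < L) :
    ∃ δ : ℝ, 0 < δ ∧ ∃ C : ℝ, 0 ≤ C ∧ ∀ (m K : ℕ) (j : ℕ) (hc : ((L : ℝ) ^ j) ≠ 0)
      (_hj : j + 1 ≤ (⟨d + 1, L, m, K, hd, hL⟩ : Params).m + (⟨d + 1, L, m, K, hd, hL⟩ : Params).K)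
      (Λ' : Finset (Site (⟨d + 1, L, m, K, hd, hL⟩ : Params) (j + 1))) (w : CIdx j Λ' → ℝ) (_hw : ∀ i, 0 < w i) (lam : Fin (d + 1))
      (b₁ b₂ : PBond (⟨d + 1, L, m, K, hd, hL⟩ : Params) 0) (_hdir : b₁.dir = b₂.dir) (_hle : supDist b₁.src b₂.src ≤ L ^ j) (y : Site (⟨d + 1, L, m, K, hd, hL⟩ : Params) j),
      ∑ b₀' ∈ univ.filter (fun b₀' : PBond (⟨d + 1, L, m, K, hd, hL⟩ : Params) 0 => iterBlockOf j b₀'.src = y),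
          |(((((L : ℝ) ^ j) • (onE (LinearMap.funLeft ℝ ℝ (fun b : PBond (⟨d + 1, L, m, K, hd, hL⟩ : Params) 0 =>
              (⟨b.src.shift lam, b.dir⟩ : PBond (⟨d + 1, L, m, K, hd, hL⟩ : Params) 0))) - LinearMap.id) :
          BondSpace (⟨d + 1, L, m, K, hd, hL⟩ : Params) →ₗ[ℝ] BondSpace (⟨d + 1, L, m, K, hd, hL⟩ : Params))) ∘ₗ (tsV1 hc Λ' w).K1) (EuclideanSpace.single b₀' (1 : ℝ)) b₁ -
           (((((L : ℝ) ^ j) • (onE (LinearMap.funLeft ℝ ℝ (fun b : PBond (⟨d + 1, L, m, K, hd, hL⟩ : Params) 0 =>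
              (⟨b.src.shift lam, b.dir⟩ : PBond (⟨d + 1, L, m, K, hd, hL⟩ : Params) 0))) - LinearMap.id) :
          BondSpace (⟨d + 1, L, m, K, hd, hL⟩ : Params) →ₗ[ℝ] BondSpace (⟨d + 1, L, m, K, hd, hL⟩ : Params))) ∘ₗ (tsV1 hc Λ' w).K1) (EuclideanSpace.single b₀' (1 : ℝ)) b₂| ≤
        C * (((supDist b₁.src b₂.src : ℕ) : ℝ) / (L : ℝ) ^ j) * Real.exp (-(δ * torusSupNorm (Mk (⟨d + 1, L, m, K, hd, hL⟩ : Params) j)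
            (rep (Mk (⟨d + 1, L, m, K, hd, hL⟩ : Params) j) (iterBlockOf j b₁.src) - rep (Mk (⟨d + 1, L, m, K, hd, hL⟩ : Params) j) y))) := by
  obtain ⟨δC, hδC, E, hE, hCov⟩ := cov_entry_uniform d L hd hL
  set κH : ℝ := kappaN (d + 1) / ((d : ℝ) + 1) with hκH
  have hκH0 : 0 < κH := div_pos (kappaN_pos _) (by positivity)
  set δ₁ : ℝ := min (δC / 2) κH with hδ₁
  set δ₂ : ℝ := min (δC / 2) (κH / 2) with hδ₂
  have hδ₁0 : 0 < δ₁ := lt_min (half_pos hδC) hκH0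
  have hδ₂0 : 0 < δ₂ := lt_min (half_pos hδC) (half_pos hκH0)
  have hδ₁C : δ₁ < δC := lt_of_le_of_lt (min_le_left _ _) (half_lt_self hδC)
  have hδ₁H : δ₁ ≤ κH := min_le_right _ _
  have hδ₂₁ : δ₂ ≤ δ₁ := le_min (min_le_left _ _) ((min_le_right _ _).trans (half_le_self hκH0.le))
  have hδ₂H : δ₂ < κH := lt_of_le_of_lt (min_le_right _ _) (half_lt_self hκH0)
  set K₁ : ℝ := latticeConst (d + 1) (δC - δ₁) with hK₁
  set K₂ : ℝ := latticeConst (d + 1) (κH - δ₂) with hK₂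
  have hK₁0 : 0 ≤ K₁ := latticeConst_nonneg _ (by linarith)
  have hK₂0 : 0 ≤ K₂ := latticeConst_nonneg _ (by linarith)
  have hL0 : 0 < L := by have := hL.2; omega
  haveI : NeZero L := ⟨by omega⟩
  have hLp : (0 : ℝ) < L := by exact_mod_cast hL0
  set Af : ℝ := ((d + 1 : ℕ) : ℝ) * (MGHD (d + 1) 3 * periodConst (kappaN (d + 1)) d) * Real.exp κH with hAf
  have hAf0 : 0 ≤ Af := by
    have := MGHD_nonneg (d + 1) 3
    have := periodConst_pos (kappaN_pos (d + 1)) d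
    positivity
  set Ah : ℝ := MGHD (d + 1) 1 * periodConst (kappaN (d + 1)) d with hAh
  have hAh0 : 0 ≤ Ah := mul_nonneg (MGHD_nonneg _ _) (periodConst_pos (kappaN_pos _) _).le
  set C : ℝ := Af * (E * (Ah * ((d + 1 : ℕ) : ℝ)) * K₁) * K₂ with hC
  have hC0 : 0 ≤ C := by positivity
  refine ⟨δ₂, hδ₂0, C, hC0, ?_⟩
  intro m K j hc hj Λ' w hw lam b₁ b₂ hdir hle y
  have hj' : j ≤ m + K := Nat.le_of_succ_le hj
  set n : ℝ := ((L : ℝ) ^ j) ^ (d + 1) with hn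
  have hn0 : 0 < n := by positivity
  have hLj : (0 : ℝ) < (L : ℝ) ^ j := by positivity
  have ht0 : 0 ≤ (((supDist b₁.src b₂.src : ℕ) : ℝ) / (L : ℝ) ^ j) := by positivity
  have hρ : IsPseudoDist (fun t t' : Site (⟨d + 1, L, m, K, hd, hL⟩ : Params) j => torusSupNorm (Mk (⟨d + 1, L, m, K, hd, hL⟩ : Params) j) (rep (Mk (⟨d + 1, L, m, K, hd, hL⟩ : Params) j) t - rep (Mk (⟨d + 1, L, m, K, hd, hL⟩ : Params) j) t')) := torusDist_isPseudoDist (Mk (⟨d + 1, L, m, K, hd, hL⟩ : Params) j)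
  have hK : SumBound (fun t t' : Site (⟨d + 1, L, m, K, hd, hL⟩ : Params) j => torusSupNorm (Mk (⟨d + 1, L, m, K, hd, hL⟩ : Params) j) (rep (Mk (⟨d + 1, L, m, K, hd, hL⟩ : Params) j) t - rep (Mk (⟨d + 1, L, m, K, hd, hL⟩ : Params) j) t')) (fun a => latticeConst (d + 1) a) := torusDist_sumBound (Mk (⟨d + 1, L, m, K, hd, hL⟩ : Params) j)
  have h1 : |(L : ℝ) ^ j| / (L : ℝ) ^ j = 1 := by rw [abs_of_pos hLj, div_self hc]
  have hcast : (((L ^ j) ^ (d + 1) * (d + 1) : ℕ) : ℝ) = n * ((d + 1 : ℕ) : ℝ) := by rw [hn]; push_cast; ring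
  have hθ : ((L : ℝ) ^ j / (L : ℝ) ^ j) ^ 4 * ((L : ℝ) ^ j) ^ (d + 1) = n := by rw [div_self hc, one_pow, one_mul]
  -- the first factor `D_λ∂H′_j`: pair bound `(A_f·t, κ)` anchored at `y(x)` (file 2)
  have hf : ∀ y' : Site (⟨d + 1, L, m, K, hd, hL⟩ : Params) j, ∑ y'' ∈ univ.filter (fun y'' : Site (⟨d + 1, L, m, K, hd, hL⟩ : Params) j => y'' = y'),
      |(((((L : ℝ) ^ j) • (onE (LinearMap.funLeft ℝ ℝ (fun b : PBond (⟨d + 1, L, m, K, hd, hL⟩ : Params) 0 =>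
              (⟨b.src.shift lam, b.dir⟩ : PBond (⟨d + 1, L, m, K, hd, hL⟩ : Params) 0))) - LinearMap.id) :
          BondSpace (⟨d + 1, L, m, K, hd, hL⟩ : Params) →ₗ[ℝ] BondSpace (⟨d + 1, L, m, K, hd, hL⟩ : Params))) ∘ₗ ((tsV1 hc Λ' w).grad ∘ₗ (tsV1 hc Λ' w).hP)) (EuclideanSpace.single y'' (1 : ℝ)) b₁ -
       (((((L : ℝ) ^ j) • (onE (LinearMap.funLeft ℝ ℝ (fun b : PBond (⟨d + 1, L, m, K, hd, hL⟩ : Params) 0 =>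
              (⟨b.src.shift lam, b.dir⟩ : PBond (⟨d + 1, L, m, K, hd, hL⟩ : Params) 0))) - LinearMap.id) :
          BondSpace (⟨d + 1, L, m, K, hd, hL⟩ : Params) →ₗ[ℝ] BondSpace (⟨d + 1, L, m, K, hd, hL⟩ : Params))) ∘ₗ ((tsV1 hc Λ' w).grad ∘ₗ (tsV1 hc Λ' w).hP)) (EuclideanSpace.single y'' (1 : ℝ)) b₂| ≤
      Af * (((supDist b₁.src b₂.src : ℕ) : ℝ) / (L : ℝ) ^ j) * Real.exp (-(κH * torusSupNorm (Mk (⟨d + 1, L, m, K, hd, hL⟩ : Params) j) (rep (Mk (⟨d + 1, L, m, K, hd, hL⟩ : Params) j) (iterBlockOf j b₁.src) - rep (Mk (⟨d + 1, L, m, K, hd, hL⟩ : Params) j) y'))) := by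
    intro y'
    refine (holderBound_DgradHp hc hj' Λ' w lam b₁ b₂ hdir hle y').trans (le_of_eq ?_)
    rw [h1, hAf, Nat.cast_one]; ring
  -- the tail factors (p22 file 4): `(∂H′_j)*` `(A_h n^{d+1}(d+1), κ)`, `C^{(j)}_Λ` `(E/n^{d+1}, δ_C)`
  have hTs : ∀ (y' y : Site (⟨d + 1, L, m, K, hd, hL⟩ : Params) j),
      ∑ b₀ ∈ univ.filter (fun b₀ : PBond (⟨d + 1, L, m, K, hd, hL⟩ : Params) 0 => iterBlockOf j b₀.src = y),
          |LinearMap.adjoint ((tsV1 hc Λ' w).grad ∘ₗ (tsV1 hc Λ' w).hP) (EuclideanSpace.single b₀ (1 : ℝ)) y'| ≤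
        Ah * (n * ((d + 1 : ℕ) : ℝ)) * Real.exp (-(κH * torusSupNorm (Mk (⟨d + 1, L, m, K, hd, hL⟩ : Params) j) (rep (Mk (⟨d + 1, L, m, K, hd, hL⟩ : Params) j) y' - rep (Mk (⟨d + 1, L, m, K, hd, hL⟩ : Params) j) y))) := by
    intro y' y
    refine (blockBound_gradHp_adjoint hc hj' Λ' w y' y).trans (le_of_eq ?_)
    rw [h1, hcast]; ring
  have hCb : ∀ (x y : Site (⟨d + 1, L, m, K, hd, hL⟩ : Params) j),
      ∑ x' ∈ univ.filter (fun x' : Site (⟨d + 1, L, m, K, hd, hL⟩ : Params) j => x' = y), |(tsV1 hc Λ' w).C (EuclideanSpace.single x' (1 : ℝ)) x| ≤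
        E / n * Real.exp (-(δC * torusSupNorm (Mk (⟨d + 1, L, m, K, hd, hL⟩ : Params) j) (rep (Mk (⟨d + 1, L, m, K, hd, hL⟩ : Params) j) x - rep (Mk (⟨d + 1, L, m, K, hd, hL⟩ : Params) j) y))) := by
    intro x y
    refine (blockBound_C_of_entry hc Λ' w (E := E / n) (δ := δC) (by positivity) (fun x x' => ?_) x y).trans (le_of_eq ?_)
    · have h := hCov m K ((L : ℝ) ^ j) hc j hj Λ' w hw x x'
      rwa [hθ] at h
    · rw [Nat.cast_one, mul_one]
  -- the tail `C^{(j)}_Λ(∂H′_j)*`: block bound `(E/n^{d+1}·A_h n^{d+1}(d+1)·K₁, δ₁)`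
  have hg : ∀ (x y : Site (⟨d + 1, L, m, K, hd, hL⟩ : Params) j), ∑ b₀ ∈ univ.filter (fun b₀ : PBond (⟨d + 1, L, m, K, hd, hL⟩ : Params) 0 => iterBlockOf j b₀.src = y),
      |((tsV1 hc Λ' w).C ∘ₗ LinearMap.adjoint ((tsV1 hc Λ' w).grad ∘ₗ (tsV1 hc Λ' w).hP)) (EuclideanSpace.single b₀ (1 : ℝ)) x| ≤
      E / n * (Ah * (n * ((d + 1 : ℕ) : ℝ))) * K₁ *
        Real.exp (-(δ₁ * torusSupNorm (Mk (⟨d + 1, L, m, K, hd, hL⟩ : Params) j) (rep (Mk (⟨d + 1, L, m, K, hd, hL⟩ : Params) j) x - rep (Mk (⟨d + 1, L, m, K, hd, hL⟩ : Params) j) y))) := by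
    intro x y
    have h := blockBound_comp hρ hK (tsV1 hc Λ' w).C (LinearMap.adjoint ((tsV1 hc Λ' w).grad ∘ₗ (tsV1 hc Λ' w).hP))
      (fun x : Site (⟨d + 1, L, m, K, hd, hL⟩ : Params) j => x) (fun x : Site (⟨d + 1, L, m, K, hd, hL⟩ : Params) j => x) (fun b₀ : PBond (⟨d + 1, L, m, K, hd, hL⟩ : Params) 0 => iterBlockOf j b₀.src)
      (by positivity : 0 ≤ E / n) (by positivity : 0 ≤ Ah * (n * ((d + 1 : ℕ) : ℝ))) hδ₁0.le hδ₁H hδ₁C hCb hTs x y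
    rw [hK₁]; exact h
  rw [K1_eq (isLattice Λ' hc hj hw), ← LinearMap.comp_assoc]
  have h := holderBound_comp hρ hK (((((L : ℝ) ^ j) • (onE (LinearMap.funLeft ℝ ℝ (fun b : PBond (⟨d + 1, L, m, K, hd, hL⟩ : Params) 0 =>
              (⟨b.src.shift lam, b.dir⟩ : PBond (⟨d + 1, L, m, K, hd, hL⟩ : Params) 0))) - LinearMap.id) :
          BondSpace (⟨d + 1, L, m, K, hd, hL⟩ : Params) →ₗ[ℝ] BondSpace (⟨d + 1, L, m, K, hd, hL⟩ : Params))) ∘ₗ ((tsV1 hc Λ' w).grad ∘ₗ (tsV1 hc Λ' w).hP))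
    ((tsV1 hc Λ' w).C ∘ₗ LinearMap.adjoint ((tsV1 hc Λ' w).grad ∘ₗ (tsV1 hc Λ' w).hP))
    (fun x : Site (⟨d + 1, L, m, K, hd, hL⟩ : Params) j => x) (fun b₀ : PBond (⟨d + 1, L, m, K, hd, hL⟩ : Params) 0 => iterBlockOf j b₀.src) b₁ b₂ (iterBlockOf j b₁.src)
    (by positivity : 0 ≤ Af * (((supDist b₁.src b₂.src : ℕ) : ℝ) / (L : ℝ) ^ j)) (by positivity : 0 ≤ E / n * (Ah * (n * ((d + 1 : ℕ) : ℝ))) * K₁)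
    hδ₂0.le hδ₂₁ hδ₂H hf hg y
  refine h.trans (le_of_eq ?_)
  rw [hC, hK₁, hK₂]
  field_simp

open Classical in
/-- **`D_λK₂* = (D_λ∂H′_j)C^{(j)}_Λ(∂ΔH′_j)*` HAS AN EXPONENTIALLY DECAYING PAIR KERNEL, UNIFORMLY** (at `c = L^j`; p22's `adjoint_K2`): `δ > 0`,
`C ≥ 0` depending on `d, L` only; pair bound `(C·t, δ)`, `t = |x − x′|_∞/n ≤ 1` — first factor as in `holderBound_DK1_scaling`, tail
`C^{(j)}_Λ(∂ΔH′_j)*` (p22 file 4's `blockBound_gradLapHp_adjoint`). [cite: Balaban1984PropagatorsII, Prop. 2.5 p.246; Balaban1984PropagatorsI, (1.111) p.35] -/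
theorem holderBound_DK2adj_scaling (d L : ℕ) (hd : 1 ≤ d + 1) (hL : Odd L ∧ 1 < L) :
    ∃ δ : ℝ, 0 < δ ∧ ∃ C : ℝ, 0 ≤ C ∧ ∀ (m K : ℕ) (j : ℕ) (hc : ((L : ℝ) ^ j) ≠ 0)
      (_hj : j + 1 ≤ (⟨d + 1, L, m, K, hd, hL⟩ : Params).m + (⟨d + 1, L, m, K, hd, hL⟩ : Params).K)
      (Λ' : Finset (Site (⟨d + 1, L, m, K, hd, hL⟩ : Params) (j + 1))) (w : CIdx j Λ' → ℝ) (_hw : ∀ i, 0 < w i) (lam : Fin (d + 1))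
      (b₁ b₂ : PBond (⟨d + 1, L, m, K, hd, hL⟩ : Params) 0) (_hdir : b₁.dir = b₂.dir) (_hle : supDist b₁.src b₂.src ≤ L ^ j) (y : Site (⟨d + 1, L, m, K, hd, hL⟩ : Params) j),
      ∑ b₀' ∈ univ.filter (fun b₀' : PBond (⟨d + 1, L, m, K, hd, hL⟩ : Params) 0 => iterBlockOf j b₀'.src = y),
          |(((((L : ℝ) ^ j) • (onE (LinearMap.funLeft ℝ ℝ (fun b : PBond (⟨d + 1, L, m, K, hd, hL⟩ : Params) 0 =>
              (⟨b.src.shift lam, b.dir⟩ : PBond (⟨d + 1, L, m, K, hd, hL⟩ : Params) 0))) - LinearMap.id) :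
          BondSpace (⟨d + 1, L, m, K, hd, hL⟩ : Params) →ₗ[ℝ] BondSpace (⟨d + 1, L, m, K, hd, hL⟩ : Params))) ∘ₗ LinearMap.adjoint (tsV1 hc Λ' w).K2) (EuclideanSpace.single b₀' (1 : ℝ)) b₁ -
           (((((L : ℝ) ^ j) • (onE (LinearMap.funLeft ℝ ℝ (fun b : PBond (⟨d + 1, L, m, K, hd, hL⟩ : Params) 0 =>
              (⟨b.src.shift lam, b.dir⟩ : PBond (⟨d + 1, L, m, K, hd, hL⟩ : Params) 0))) - LinearMap.id) :
          BondSpace (⟨d + 1, L, m, K, hd, hL⟩ : Params) →ₗ[ℝ] BondSpace (⟨d + 1, L, m, K, hd, hL⟩ : Params))) ∘ₗ LinearMap.adjoint (tsV1 hc Λ' w).K2) (EuclideanSpace.single b₀' (1 : ℝ)) b₂| ≤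
        C * (((supDist b₁.src b₂.src : ℕ) : ℝ) / (L : ℝ) ^ j) * Real.exp (-(δ * torusSupNorm (Mk (⟨d + 1, L, m, K, hd, hL⟩ : Params) j)
            (rep (Mk (⟨d + 1, L, m, K, hd, hL⟩ : Params) j) (iterBlockOf j b₁.src) - rep (Mk (⟨d + 1, L, m, K, hd, hL⟩ : Params) j) y))) := by
  obtain ⟨δC, hδC, E, hE, hCov⟩ := cov_entry_uniform d L hd hL
  set κH : ℝ := kappaN (d + 1) / ((d : ℝ) + 1) with hκH
  have hκH0 : 0 < κH := div_pos (kappaN_pos _) (by positivity)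
  set δ₁ : ℝ := min (δC / 2) κH with hδ₁
  set δ₂ : ℝ := min (δC / 2) (κH / 2) with hδ₂
  have hδ₁0 : 0 < δ₁ := lt_min (half_pos hδC) hκH0
  have hδ₂0 : 0 < δ₂ := lt_min (half_pos hδC) (half_pos hκH0)
  have hδ₁C : δ₁ < δC := lt_of_le_of_lt (min_le_left _ _) (half_lt_self hδC)
  have hδ₁H : δ₁ ≤ κH := min_le_right _ _
  have hδ₂₁ : δ₂ ≤ δ₁ := le_min (min_le_left _ _) ((min_le_right _ _).trans (half_le_self hκH0.le))
  have hδ₂H : δ₂ < κH := lt_of_le_of_lt (min_le_right _ _) (half_lt_self hκH0)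
  set K₁ : ℝ := latticeConst (d + 1) (δC - δ₁) with hK₁
  set K₂ : ℝ := latticeConst (d + 1) (κH - δ₂) with hK₂
  have hK₁0 : 0 ≤ K₁ := latticeConst_nonneg _ (by linarith)
  have hK₂0 : 0 ≤ K₂ := latticeConst_nonneg _ (by linarith)
  have hL0 : 0 < L := by have := hL.2; omega
  haveI : NeZero L := ⟨by omega⟩
  have hLp : (0 : ℝ) < L := by exact_mod_cast hL0
  set Af : ℝ := ((d + 1 : ℕ) : ℝ) * (MGHD (d + 1) 3 * periodConst (kappaN (d + 1)) d) * Real.exp κH with hAf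
  have hAf0 : 0 ≤ Af := by
    have := MGHD_nonneg (d + 1) 3
    have := periodConst_pos (kappaN_pos (d + 1)) d
    positivity
  set Ah : ℝ := ((d + 1 : ℕ) : ℝ) * (MGHD (d + 1) 3 * periodConst (kappaN (d + 1)) d) * Real.exp (kappaN (d + 1) / ((d : ℝ) + 1)) with hAh
  have hAh0 : 0 ≤ Ah := by
    have := MGHD_nonneg (d + 1) 3
    have := periodConst_pos (kappaN_pos (d + 1)) d
    positivity
  set C : ℝ := Af * (E * (Ah * ((d + 1 : ℕ) : ℝ)) * K₁) * K₂ with hC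
  have hC0 : 0 ≤ C := by positivity
  refine ⟨δ₂, hδ₂0, C, hC0, ?_⟩
  intro m K j hc hj Λ' w hw lam b₁ b₂ hdir hle y
  have hj' : j ≤ m + K := Nat.le_of_succ_le hj
  set n : ℝ := ((L : ℝ) ^ j) ^ (d + 1) with hn
  have hn0 : 0 < n := by positivity
  have hLj : (0 : ℝ) < (L : ℝ) ^ j := by positivity
  have ht0 : 0 ≤ (((supDist b₁.src b₂.src : ℕ) : ℝ) / (L : ℝ) ^ j) := by positivity
  have hρ : IsPseudoDist (fun t t' : Site (⟨d + 1, L, m, K, hd, hL⟩ : Params) j => torusSupNorm (Mk (⟨d + 1, L, m, K, hd, hL⟩ : Params) j) (rep (Mk (⟨d + 1, L, m, K, hd, hL⟩ : Params) j) t - rep (Mk (⟨d + 1, L, m, K, hd, hL⟩ : Params) j) t')) := torusDist_isPseudoDist (Mk (⟨d + 1, L, m, K, hd, hL⟩ : Params) j)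
  have hK : SumBound (fun t t' : Site (⟨d + 1, L, m, K, hd, hL⟩ : Params) j => torusSupNorm (Mk (⟨d + 1, L, m, K, hd, hL⟩ : Params) j) (rep (Mk (⟨d + 1, L, m, K, hd, hL⟩ : Params) j) t - rep (Mk (⟨d + 1, L, m, K, hd, hL⟩ : Params) j) t')) (fun a => latticeConst (d + 1) a) := torusDist_sumBound (Mk (⟨d + 1, L, m, K, hd, hL⟩ : Params) j)
  have h1 : |(L : ℝ) ^ j| / (L : ℝ) ^ j = 1 := by rw [abs_of_pos hLj, div_self hc]
  have hcast : (((L ^ j) ^ (d + 1) * (d + 1) : ℕ) : ℝ) = n * ((d + 1 : ℕ) : ℝ) := by rw [hn]; push_cast; ring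
  have hθ : ((L : ℝ) ^ j / (L : ℝ) ^ j) ^ 4 * ((L : ℝ) ^ j) ^ (d + 1) = n := by rw [div_self hc, one_pow, one_mul]
  have hf : ∀ y' : Site (⟨d + 1, L, m, K, hd, hL⟩ : Params) j, ∑ y'' ∈ univ.filter (fun y'' : Site (⟨d + 1, L, m, K, hd, hL⟩ : Params) j => y'' = y'),
      |(((((L : ℝ) ^ j) • (onE (LinearMap.funLeft ℝ ℝ (fun b : PBond (⟨d + 1, L, m, K, hd, hL⟩ : Params) 0 =>
              (⟨b.src.shift lam, b.dir⟩ : PBond (⟨d + 1, L, m, K, hd, hL⟩ : Params) 0))) - LinearMap.id) :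
          BondSpace (⟨d + 1, L, m, K, hd, hL⟩ : Params) →ₗ[ℝ] BondSpace (⟨d + 1, L, m, K, hd, hL⟩ : Params))) ∘ₗ ((tsV1 hc Λ' w).grad ∘ₗ (tsV1 hc Λ' w).hP)) (EuclideanSpace.single y'' (1 : ℝ)) b₁ -
       (((((L : ℝ) ^ j) • (onE (LinearMap.funLeft ℝ ℝ (fun b : PBond (⟨d + 1, L, m, K, hd, hL⟩ : Params) 0 =>
              (⟨b.src.shift lam, b.dir⟩ : PBond (⟨d + 1, L, m, K, hd, hL⟩ : Params) 0))) - LinearMap.id) :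
          BondSpace (⟨d + 1, L, m, K, hd, hL⟩ : Params) →ₗ[ℝ] BondSpace (⟨d + 1, L, m, K, hd, hL⟩ : Params))) ∘ₗ ((tsV1 hc Λ' w).grad ∘ₗ (tsV1 hc Λ' w).hP)) (EuclideanSpace.single y'' (1 : ℝ)) b₂| ≤
      Af * (((supDist b₁.src b₂.src : ℕ) : ℝ) / (L : ℝ) ^ j) * Real.exp (-(κH * torusSupNorm (Mk (⟨d + 1, L, m, K, hd, hL⟩ : Params) j) (rep (Mk (⟨d + 1, L, m, K, hd, hL⟩ : Params) j) (iterBlockOf j b₁.src) - rep (Mk (⟨d + 1, L, m, K, hd, hL⟩ : Params) j) y'))) := by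
    intro y'
    refine (holderBound_DgradHp hc hj' Λ' w lam b₁ b₂ hdir hle y').trans (le_of_eq ?_)
    rw [h1, hAf, Nat.cast_one]; ring
  have hTs : ∀ (y' y : Site (⟨d + 1, L, m, K, hd, hL⟩ : Params) j),
      ∑ b₀ ∈ univ.filter (fun b₀ : PBond (⟨d + 1, L, m, K, hd, hL⟩ : Params) 0 => iterBlockOf j b₀.src = y),
          |LinearMap.adjoint ((tsV1 hc Λ' w).grad ∘ₗ (tsV1 hc Λ' w).lap ∘ₗ (tsV1 hc Λ' w).hP) (EuclideanSpace.single b₀ (1 : ℝ)) y'| ≤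
        Ah * (n * ((d + 1 : ℕ) : ℝ)) * Real.exp (-(κH * torusSupNorm (Mk (⟨d + 1, L, m, K, hd, hL⟩ : Params) j) (rep (Mk (⟨d + 1, L, m, K, hd, hL⟩ : Params) j) y' - rep (Mk (⟨d + 1, L, m, K, hd, hL⟩ : Params) j) y))) := by
    intro y' y
    refine (blockBound_gradLapHp_adjoint hc hj' Λ' w y' y).trans (le_of_eq ?_)
    rw [h1, hcast]; ring
  have hCb : ∀ (x y : Site (⟨d + 1, L, m, K, hd, hL⟩ : Params) j),
      ∑ x' ∈ univ.filter (fun x' : Site (⟨d + 1, L, m, K, hd, hL⟩ : Params) j => x' = y), |(tsV1 hc Λ' w).C (EuclideanSpace.single x' (1 : ℝ)) x| ≤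
        E / n * Real.exp (-(δC * torusSupNorm (Mk (⟨d + 1, L, m, K, hd, hL⟩ : Params) j) (rep (Mk (⟨d + 1, L, m, K, hd, hL⟩ : Params) j) x - rep (Mk (⟨d + 1, L, m, K, hd, hL⟩ : Params) j) y))) := by
    intro x y
    refine (blockBound_C_of_entry hc Λ' w (E := E / n) (δ := δC) (by positivity) (fun x x' => ?_) x y).trans (le_of_eq ?_)
    · have h := hCov m K ((L : ℝ) ^ j) hc j hj Λ' w hw x x'
      rwa [hθ] at h
    · rw [Nat.cast_one, mul_one]
  have hg : ∀ (x y : Site (⟨d + 1, L, m, K, hd, hL⟩ : Params) j), ∑ b₀ ∈ univ.filter (fun b₀ : PBond (⟨d + 1, L, m, K, hd, hL⟩ : Params) 0 => iterBlockOf j b₀.src = y),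
      |((tsV1 hc Λ' w).C ∘ₗ LinearMap.adjoint ((tsV1 hc Λ' w).grad ∘ₗ (tsV1 hc Λ' w).lap ∘ₗ (tsV1 hc Λ' w).hP)) (EuclideanSpace.single b₀ (1 : ℝ)) x| ≤
      E / n * (Ah * (n * ((d + 1 : ℕ) : ℝ))) * K₁ *
        Real.exp (-(δ₁ * torusSupNorm (Mk (⟨d + 1, L, m, K, hd, hL⟩ : Params) j) (rep (Mk (⟨d + 1, L, m, K, hd, hL⟩ : Params) j) x - rep (Mk (⟨d + 1, L, m, K, hd, hL⟩ : Params) j) y))) := by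
    intro x y
    have h := blockBound_comp hρ hK (tsV1 hc Λ' w).C (LinearMap.adjoint ((tsV1 hc Λ' w).grad ∘ₗ (tsV1 hc Λ' w).lap ∘ₗ (tsV1 hc Λ' w).hP))
      (fun x : Site (⟨d + 1, L, m, K, hd, hL⟩ : Params) j => x) (fun x : Site (⟨d + 1, L, m, K, hd, hL⟩ : Params) j => x) (fun b₀ : PBond (⟨d + 1, L, m, K, hd, hL⟩ : Params) 0 => iterBlockOf j b₀.src)
      (by positivity : 0 ≤ E / n) (by positivity : 0 ≤ Ah * (n * ((d + 1 : ℕ) : ℝ))) hδ₁0.le hδ₁H hδ₁C hCb hTs x y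
    rw [hK₁]; exact h
  rw [adjoint_K2 (isLattice Λ' hc hj hw) (positive Λ' hc hj w), ← LinearMap.comp_assoc]
  have h := holderBound_comp hρ hK (((((L : ℝ) ^ j) • (onE (LinearMap.funLeft ℝ ℝ (fun b : PBond (⟨d + 1, L, m, K, hd, hL⟩ : Params) 0 =>
              (⟨b.src.shift lam, b.dir⟩ : PBond (⟨d + 1, L, m, K, hd, hL⟩ : Params) 0))) - LinearMap.id) :
          BondSpace (⟨d + 1, L, m, K, hd, hL⟩ : Params) →ₗ[ℝ] BondSpace (⟨d + 1, L, m, K, hd, hL⟩ : Params))) ∘ₗ ((tsV1 hc Λ' w).grad ∘ₗ (tsV1 hc Λ' w).hP))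
    ((tsV1 hc Λ' w).C ∘ₗ LinearMap.adjoint ((tsV1 hc Λ' w).grad ∘ₗ (tsV1 hc Λ' w).lap ∘ₗ (tsV1 hc Λ' w).hP))
    (fun x : Site (⟨d + 1, L, m, K, hd, hL⟩ : Params) j => x) (fun b₀ : PBond (⟨d + 1, L, m, K, hd, hL⟩ : Params) 0 => iterBlockOf j b₀.src) b₁ b₂ (iterBlockOf j b₁.src)
    (by positivity : 0 ≤ Af * (((supDist b₁.src b₂.src : ℕ) : ℝ) / (L : ℝ) ^ j)) (by positivity : 0 ≤ E / n * (Ah * (n * ((d + 1 : ℕ) : ℝ))) * K₁)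
    hδ₂0.le hδ₂₁ hδ₂H hf hg y
  refine h.trans (le_of_eq ?_)
  rw [hC, hK₁, hK₂]
  field_simp

/-! ## §2  The two `H_j`-led summands: `α`-HÖLDER pair bounds -/

open Classical in
/-- **`D_λ(H_jC̃^{(j)}_ΛH_j*) = (D_λH_j)C̃^{(j)}_ΛH_j*` HAS AN EXPONENTIALLY DECAYING PAIR KERNEL** (at `c = L^j`, weights `a₀n^{d+1} ≤ w ≤ a₁n^{d+1}`):
there is `δ > 0` (depending on `d, L, a₀, a₁`) and for every `0 ≤ α < 1` a `C_α ≥ 0` with the pair bound `(C_α·t^α, δ(1−α))`, `t = |x − x′|_∞/n ≤ 1`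
— first factor `D_λH_j` (file 3's `holderBound_DHj`, rate `κ_H(1−α)/(1+α) > δ(1−α)`), tail `C̃^{(j)}_ΛH_j*` (p22's `blockBound_Ct_scaling`,
`blockBound_Hj_adjoint`). [cite: Balaban1984PropagatorsII, Prop. 2.5 p.246, (2.130) p.246; Balaban1984PropagatorsI, (1.111) p.35] -/
theorem holderBound_DHjCtHj_scaling (d L : ℕ) (hd : 1 ≤ d + 1) (hL : Odd L ∧ 1 < L) {a₀ a₁ : ℝ} (ha₀ : 0 < a₀) (ha₁ : a₀ ≤ a₁) :
    ∃ δ : ℝ, 0 < δ ∧ ∀ α : ℝ, 0 ≤ α → α < 1 → ∃ C : ℝ, 0 ≤ C ∧ ∀ (m K : ℕ) (j : ℕ) (hc : ((L : ℝ) ^ j) ≠ 0)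
      (_hj : j + 1 ≤ (⟨d + 1, L, m, K, hd, hL⟩ : Params).m + (⟨d + 1, L, m, K, hd, hL⟩ : Params).K)
      (Λ' : Finset (Site (⟨d + 1, L, m, K, hd, hL⟩ : Params) (j + 1))) (w : CIdx j Λ' → ℝ)
      (_hw0 : ∀ i, a₀ * ((L : ℝ) ^ j) ^ (d + 1) ≤ w i) (_hw1 : ∀ i, w i ≤ a₁ * ((L : ℝ) ^ j) ^ (d + 1)) (lam : Fin (d + 1))
      (b₁ b₂ : PBond (⟨d + 1, L, m, K, hd, hL⟩ : Params) 0) (_hdir : b₁.dir = b₂.dir) (_hle : supDist b₁.src b₂.src ≤ L ^ j) (y : Site (⟨d + 1, L, m, K, hd, hL⟩ : Params) j),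
      ∑ b₀' ∈ univ.filter (fun b₀' : PBond (⟨d + 1, L, m, K, hd, hL⟩ : Params) 0 => iterBlockOf j b₀'.src = y),
          |(((((L : ℝ) ^ j) • (onE (LinearMap.funLeft ℝ ℝ (fun b : PBond (⟨d + 1, L, m, K, hd, hL⟩ : Params) 0 =>
              (⟨b.src.shift lam, b.dir⟩ : PBond (⟨d + 1, L, m, K, hd, hL⟩ : Params) 0))) - LinearMap.id) :
          BondSpace (⟨d + 1, L, m, K, hd, hL⟩ : Params) →ₗ[ℝ] BondSpace (⟨d + 1, L, m, K, hd, hL⟩ : Params))) ∘ₗ ((tsV1 hc Λ' w).Hj ∘ₗ (tsV1 hc Λ' w).Ct ∘ₗ LinearMap.adjoint (tsV1 hc Λ' w).Hj)) (EuclideanSpace.single b₀' (1 : ℝ)) b₁ -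
           (((((L : ℝ) ^ j) • (onE (LinearMap.funLeft ℝ ℝ (fun b : PBond (⟨d + 1, L, m, K, hd, hL⟩ : Params) 0 =>
              (⟨b.src.shift lam, b.dir⟩ : PBond (⟨d + 1, L, m, K, hd, hL⟩ : Params) 0))) - LinearMap.id) :
          BondSpace (⟨d + 1, L, m, K, hd, hL⟩ : Params) →ₗ[ℝ] BondSpace (⟨d + 1, L, m, K, hd, hL⟩ : Params))) ∘ₗ ((tsV1 hc Λ' w).Hj ∘ₗ (tsV1 hc Λ' w).Ct ∘ₗ LinearMap.adjoint (tsV1 hc Λ' w).Hj)) (EuclideanSpace.single b₀' (1 : ℝ)) b₂| ≤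
        C * (((supDist b₁.src b₂.src : ℕ) : ℝ) / (L : ℝ) ^ j) ^ α * Real.exp (-(δ * (1 - α) * torusSupNorm (Mk (⟨d + 1, L, m, K, hd, hL⟩ : Params) j)
            (rep (Mk (⟨d + 1, L, m, K, hd, hL⟩ : Params) j) (iterBlockOf j b₁.src) - rep (Mk (⟨d + 1, L, m, K, hd, hL⟩ : Params) j) y))) := by
  obtain ⟨δC, hδC, E, hE, hCt⟩ := blockBound_Ct_scaling d L hd hL ha₀ ha₁
  set κH : ℝ := kappa163 (d + 1) / ((d : ℝ) + 1) with hκH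
  have hκH0 : 0 < κH := div_pos (kappa163_pos _) (by positivity)
  -- rates: the tail at `δ₁ = min(δ_C/2, κ_H)`; the product at `δ(1−α)`, `δ = min(δ_C/2, κ_H/4)` (`δ(1−α) ≤ δ₁`, `δ(1−α) < κ_H(1−α)/(1+α)`)
  set δ₁ : ℝ := min (δC / 2) κH with hδ₁
  have hδ₁0 : 0 < δ₁ := lt_min (half_pos hδC) hκH0
  have hδ₁C : δ₁ < δC := lt_of_le_of_lt (min_le_left _ _) (half_lt_self hδC)
  have hδ₁H : δ₁ ≤ κH := min_le_right _ _
  set δ : ℝ := min (δC / 2) (κH / 4) with hδ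
  have hδ0 : 0 < δ := lt_min (half_pos hδC) (by linarith)
  have hδδ₁ : δ ≤ δ₁ := le_min (min_le_left _ _) ((min_le_right _ _).trans (by linarith))
  have hδH : δ ≤ κH / 4 := min_le_right _ _
  set K₁ : ℝ := latticeConst (d + 1) (δC - δ₁) with hK₁
  have hK₁0 : 0 ≤ K₁ := latticeConst_nonneg _ (by linarith)
  have hL0 : 0 < L := by have := hL.2; omega
  haveI : NeZero L := ⟨by omega⟩
  have hLp : (0 : ℝ) < L := by exact_mod_cast hL0
  set AH : ℝ := MG163 (d + 1) * periodConst (kappa163 (d + 1)) d with hAH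
  have hAH0 : 0 ≤ AH := mul_nonneg (MG163_nonneg _) (periodConst_pos (kappa163_pos _) _).le
  refine ⟨δ, hδ0, fun α hα0 hα1 => ?_⟩
  have h1α : 0 < 1 - α := by linarith
  have h1pα : 0 < 1 + α := by linarith
  have hpos : 0 < κH * (1 - α) := mul_pos hκH0 h1α
  have hδ'0 : 0 ≤ δ * (1 - α) := by positivity
  have hδ'b : δ * (1 - α) ≤ δ₁ := (mul_le_of_le_one_right hδ0.le (by linarith)).trans hδδ₁
  have hδ'a : δ * (1 - α) < κH * ((1 - α) / (1 + α)) := by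
    rw [← mul_div_assoc, lt_div_iff₀ h1pα]
    calc δ * (1 - α) * (1 + α) ≤ κH / 4 * (1 - α) * (1 + α) :=
          mul_le_mul_of_nonneg_right (mul_le_mul_of_nonneg_right hδH h1α.le) h1pα.le
      _ = κH * (1 - α) * ((1 + α) / 4) := by ring
      _ < κH * (1 - α) * 1 := mul_lt_mul_of_pos_left (by linarith) hpos
      _ = κH * (1 - α) := mul_one _
  have hCHD : 0 ≤ CHD d α := CHD_nonneg (d := d) hα0 hα1
  set K₂ : ℝ := latticeConst (d + 1) (κH * ((1 - α) / (1 + α)) - δ * (1 - α)) with hK₂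
  have hK₂0 : 0 ≤ K₂ := latticeConst_nonneg _ (by linarith)
  set AD : ℝ := CHD d α * ((d + 1 : ℕ) : ℝ) * Real.exp κH * ((1 * (d + 1) : ℕ) : ℝ) with hAD
  have hAD0 : 0 ≤ AD := by positivity
  set C : ℝ := AD * (E * (AH * ((d + 1 : ℕ) : ℝ)) * K₁) * K₂ with hC
  have hC0 : 0 ≤ C := by positivity
  refine ⟨C, hC0, ?_⟩
  intro m K j hc hj Λ' w hw0 hw1 lam b₁ b₂ hdir hle y
  have hj' : j ≤ m + K := Nat.le_of_succ_le hj
  set n : ℝ := ((L : ℝ) ^ j) ^ (d + 1) with hn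
  have hn0 : 0 < n := by positivity
  have hLj : (0 : ℝ) < (L : ℝ) ^ j := by positivity
  have hw : ∀ i, 0 < w i := fun i => lt_of_lt_of_le (by positivity) (hw0 i)
  have ht0 : 0 ≤ (((supDist b₁.src b₂.src : ℕ) : ℝ) / (L : ℝ) ^ j) ^ α := Real.rpow_nonneg (by positivity) _
  have hρ : IsPseudoDist (fun t t' : Site (⟨d + 1, L, m, K, hd, hL⟩ : Params) j => torusSupNorm (Mk (⟨d + 1, L, m, K, hd, hL⟩ : Params) j) (rep (Mk (⟨d + 1, L, m, K, hd, hL⟩ : Params) j) t - rep (Mk (⟨d + 1, L, m, K, hd, hL⟩ : Params) j) t')) := torusDist_isPseudoDist (Mk (⟨d + 1, L, m, K, hd, hL⟩ : Params) j)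
  have hK : SumBound (fun t t' : Site (⟨d + 1, L, m, K, hd, hL⟩ : Params) j => torusSupNorm (Mk (⟨d + 1, L, m, K, hd, hL⟩ : Params) j) (rep (Mk (⟨d + 1, L, m, K, hd, hL⟩ : Params) j) t - rep (Mk (⟨d + 1, L, m, K, hd, hL⟩ : Params) j) t')) (fun a => latticeConst (d + 1) a) := torusDist_sumBound (Mk (⟨d + 1, L, m, K, hd, hL⟩ : Params) j)
  have hcast : (((L ^ j) ^ (d + 1) * (d + 1) : ℕ) : ℝ) = n * ((d + 1 : ℕ) : ℝ) := by rw [hn]; push_cast; ring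
  -- the first factor `D_λH_j`: pair bound `(CHD(d+1)e^{κ_H}t^α(d+1), κ_H(1−α)/(1+α))` (file 3)
  have hf : ∀ y' : Site (⟨d + 1, L, m, K, hd, hL⟩ : Params) j, ∑ b ∈ univ.filter (fun b : PBond (⟨d + 1, L, m, K, hd, hL⟩ : Params) j => b.src = y'),
      |(((((L : ℝ) ^ j) • (onE (LinearMap.funLeft ℝ ℝ (fun b : PBond (⟨d + 1, L, m, K, hd, hL⟩ : Params) 0 =>
              (⟨b.src.shift lam, b.dir⟩ : PBond (⟨d + 1, L, m, K, hd, hL⟩ : Params) 0))) - LinearMap.id) :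
          BondSpace (⟨d + 1, L, m, K, hd, hL⟩ : Params) →ₗ[ℝ] BondSpace (⟨d + 1, L, m, K, hd, hL⟩ : Params))) ∘ₗ (tsV1 hc Λ' w).Hj) (EuclideanSpace.single b (1 : ℝ)) b₁ -
       (((((L : ℝ) ^ j) • (onE (LinearMap.funLeft ℝ ℝ (fun b : PBond (⟨d + 1, L, m, K, hd, hL⟩ : Params) 0 =>
              (⟨b.src.shift lam, b.dir⟩ : PBond (⟨d + 1, L, m, K, hd, hL⟩ : Params) 0))) - LinearMap.id) :
          BondSpace (⟨d + 1, L, m, K, hd, hL⟩ : Params) →ₗ[ℝ] BondSpace (⟨d + 1, L, m, K, hd, hL⟩ : Params))) ∘ₗ (tsV1 hc Λ' w).Hj) (EuclideanSpace.single b (1 : ℝ)) b₂| ≤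
      CHD d α * ((d + 1 : ℕ) : ℝ) * Real.exp κH * (((supDist b₁.src b₂.src : ℕ) : ℝ) / (L : ℝ) ^ j) ^ α * ((1 * (d + 1) : ℕ) : ℝ) *
        Real.exp (-(κH * ((1 - α) / (1 + α)) *
          torusSupNorm (Mk (⟨d + 1, L, m, K, hd, hL⟩ : Params) j) (rep (Mk (⟨d + 1, L, m, K, hd, hL⟩ : Params) j) (iterBlockOf j b₁.src) - rep (Mk (⟨d + 1, L, m, K, hd, hL⟩ : Params) j) y'))) :=
    fun y' => holderBound_DHj hc hj Λ' hw hα0 hα1 lam b₁ b₂ hdir hle y'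
  -- the tail factors: `H_j*` `(A_H n^{d+1}(d+1), κ_H)` (p22 file 3), `C̃^{(j)}_Λ` `(E/n^{d+1}, δ_C)` (p22 file 8)
  have hTs : ∀ (b : PBond (⟨d + 1, L, m, K, hd, hL⟩ : Params) j) (y : Site (⟨d + 1, L, m, K, hd, hL⟩ : Params) j),
      ∑ b₀ ∈ univ.filter (fun b₀ : PBond (⟨d + 1, L, m, K, hd, hL⟩ : Params) 0 => iterBlockOf j b₀.src = y),
          |LinearMap.adjoint (tsV1 hc Λ' w).Hj (EuclideanSpace.single b₀ (1 : ℝ)) b| ≤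
        AH * (n * ((d + 1 : ℕ) : ℝ)) * Real.exp (-(κH * torusSupNorm (Mk (⟨d + 1, L, m, K, hd, hL⟩ : Params) j) (rep (Mk (⟨d + 1, L, m, K, hd, hL⟩ : Params) j) b.src - rep (Mk (⟨d + 1, L, m, K, hd, hL⟩ : Params) j) y))) := by
    intro b y
    refine (blockBound_Hj_adjoint hc hj Λ' hw b y).trans (le_of_eq ?_)
    rw [hcast]
  have hCb : ∀ (b : PBond (⟨d + 1, L, m, K, hd, hL⟩ : Params) j) (y : Site (⟨d + 1, L, m, K, hd, hL⟩ : Params) j),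
      ∑ b' ∈ univ.filter (fun b' : PBond (⟨d + 1, L, m, K, hd, hL⟩ : Params) j => b'.src = y), |(tsV1 hc Λ' w).Ct (EuclideanSpace.single b' (1 : ℝ)) b| ≤
        E / n * Real.exp (-(δC * torusSupNorm (Mk (⟨d + 1, L, m, K, hd, hL⟩ : Params) j) (rep (Mk (⟨d + 1, L, m, K, hd, hL⟩ : Params) j) b.src - rep (Mk (⟨d + 1, L, m, K, hd, hL⟩ : Params) j) y))) :=
    fun b y => hCt m K j hc hj Λ' w hw0 hw1 b y
  -- the tail `C̃^{(j)}_ΛH_j*`: block bound `(E/n^{d+1}·A_H n^{d+1}(d+1)·K₁, δ₁)`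
  have hg : ∀ (b : PBond (⟨d + 1, L, m, K, hd, hL⟩ : Params) j) (y : Site (⟨d + 1, L, m, K, hd, hL⟩ : Params) j), ∑ b₀ ∈ univ.filter (fun b₀ : PBond (⟨d + 1, L, m, K, hd, hL⟩ : Params) 0 => iterBlockOf j b₀.src = y),
      |((tsV1 hc Λ' w).Ct ∘ₗ LinearMap.adjoint (tsV1 hc Λ' w).Hj) (EuclideanSpace.single b₀ (1 : ℝ)) b| ≤
      E / n * (AH * (n * ((d + 1 : ℕ) : ℝ))) * K₁ *
        Real.exp (-(δ₁ * torusSupNorm (Mk (⟨d + 1, L, m, K, hd, hL⟩ : Params) j) (rep (Mk (⟨d + 1, L, m, K, hd, hL⟩ : Params) j) b.src - rep (Mk (⟨d + 1, L, m, K, hd, hL⟩ : Params) j) y))) := by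
    intro b y
    have h := blockBound_comp hρ hK (tsV1 hc Λ' w).Ct (LinearMap.adjoint (tsV1 hc Λ' w).Hj)
      (fun b : PBond (⟨d + 1, L, m, K, hd, hL⟩ : Params) j => b.src) (fun b : PBond (⟨d + 1, L, m, K, hd, hL⟩ : Params) j => b.src) (fun b₀ : PBond (⟨d + 1, L, m, K, hd, hL⟩ : Params) 0 => iterBlockOf j b₀.src)
      (by positivity : 0 ≤ E / n) (by positivity : 0 ≤ AH * (n * ((d + 1 : ℕ) : ℝ))) hδ₁0.le hδ₁H hδ₁C hCb hTs b y
    rw [hK₁]; exact h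
  rw [← LinearMap.comp_assoc]
  have h := holderBound_comp hρ hK (((((L : ℝ) ^ j) • (onE (LinearMap.funLeft ℝ ℝ (fun b : PBond (⟨d + 1, L, m, K, hd, hL⟩ : Params) 0 =>
              (⟨b.src.shift lam, b.dir⟩ : PBond (⟨d + 1, L, m, K, hd, hL⟩ : Params) 0))) - LinearMap.id) :
          BondSpace (⟨d + 1, L, m, K, hd, hL⟩ : Params) →ₗ[ℝ] BondSpace (⟨d + 1, L, m, K, hd, hL⟩ : Params))) ∘ₗ (tsV1 hc Λ' w).Hj) ((tsV1 hc Λ' w).Ct ∘ₗ LinearMap.adjoint (tsV1 hc Λ' w).Hj)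
    (fun b : PBond (⟨d + 1, L, m, K, hd, hL⟩ : Params) j => b.src) (fun b₀ : PBond (⟨d + 1, L, m, K, hd, hL⟩ : Params) 0 => iterBlockOf j b₀.src) b₁ b₂ (iterBlockOf j b₁.src)
    (by positivity : 0 ≤ CHD d α * ((d + 1 : ℕ) : ℝ) * Real.exp κH * (((supDist b₁.src b₂.src : ℕ) : ℝ) / (L : ℝ) ^ j) ^ α * ((1 * (d + 1) : ℕ) : ℝ))
    (by positivity : 0 ≤ E / n * (AH * (n * ((d + 1 : ℕ) : ℝ))) * K₁)
    hδ'0 hδ'b hδ'a hf hg y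
  refine h.trans (le_of_eq ?_)
  have hn' : E / n * (AH * (n * ((d + 1 : ℕ) : ℝ))) = E * (AH * ((d + 1 : ℕ) : ℝ)) := by
    field_simp
  rw [hn', hC, hAD, hK₁, hK₂]
  ring

open Classical in
/-- **`D_λG̃_j` HAS AN EXPONENTIALLY DECAYING PAIR KERNEL** (at `c = L^j`): there is `δ > 0` depending on `d, L` only and for every `0 ≤ α < 1` a
`C_α ≥ 0` with the pair bound `(C_α·t^α, δ(1−α))` — `D_λG̃_j = D_λG^{(n^{d+1})} − (D_λH_j)(Q_jG^{(n^{d+1})})` (p22's `Gt_eq_comp_GE` at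
`w′ = n^{d+1}`): `D_λG^{(n^{d+1})}` has the pair bound `(C_α t^α, δ₀)` of [4] Prop. 1.2 (1.111) (file 3b's `holderBound_DGE_scaling`), `D_λH_j` the pair
bound of file 3, and `Q_jG^{(n^{d+1})}` the block bound `(e^{κ_H}C_G K, δ₁)` (p22 file 6). [cite: Balaban1984PropagatorsII, (2.131) p.246, Prop. 2.5 p.246;
Balaban1984PropagatorsI, (1.111) p.35] -/
theorem holderBound_DGt_scaling (d L : ℕ) (hd : 1 ≤ d + 1) (hL : Odd L ∧ 1 < L) :
    ∃ δ : ℝ, 0 < δ ∧ ∀ α : ℝ, 0 ≤ α → α < 1 → ∃ C : ℝ, 0 ≤ C ∧ ∀ (m K : ℕ) (j : ℕ) (hc : ((L : ℝ) ^ j) ≠ 0)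
      (_hj : j + 1 ≤ (⟨d + 1, L, m, K, hd, hL⟩ : Params).m + (⟨d + 1, L, m, K, hd, hL⟩ : Params).K)
      (Λ' : Finset (Site (⟨d + 1, L, m, K, hd, hL⟩ : Params) (j + 1))) (w : CIdx j Λ' → ℝ) (_hw : ∀ i, 0 < w i) (lam : Fin (d + 1))
      (b₁ b₂ : PBond (⟨d + 1, L, m, K, hd, hL⟩ : Params) 0) (_hdir : b₁.dir = b₂.dir) (_hle : supDist b₁.src b₂.src ≤ L ^ j) (y : Site (⟨d + 1, L, m, K, hd, hL⟩ : Params) j),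
      ∑ b₀' ∈ univ.filter (fun b₀' : PBond (⟨d + 1, L, m, K, hd, hL⟩ : Params) 0 => iterBlockOf j b₀'.src = y),
          |(((((L : ℝ) ^ j) • (onE (LinearMap.funLeft ℝ ℝ (fun b : PBond (⟨d + 1, L, m, K, hd, hL⟩ : Params) 0 =>
              (⟨b.src.shift lam, b.dir⟩ : PBond (⟨d + 1, L, m, K, hd, hL⟩ : Params) 0))) - LinearMap.id) :
          BondSpace (⟨d + 1, L, m, K, hd, hL⟩ : Params) →ₗ[ℝ] BondSpace (⟨d + 1, L, m, K, hd, hL⟩ : Params))) ∘ₗ (tsV1 hc Λ' w).Gt) (EuclideanSpace.single b₀' (1 : ℝ)) b₁ -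
           (((((L : ℝ) ^ j) • (onE (LinearMap.funLeft ℝ ℝ (fun b : PBond (⟨d + 1, L, m, K, hd, hL⟩ : Params) 0 =>
              (⟨b.src.shift lam, b.dir⟩ : PBond (⟨d + 1, L, m, K, hd, hL⟩ : Params) 0))) - LinearMap.id) :
          BondSpace (⟨d + 1, L, m, K, hd, hL⟩ : Params) →ₗ[ℝ] BondSpace (⟨d + 1, L, m, K, hd, hL⟩ : Params))) ∘ₗ (tsV1 hc Λ' w).Gt) (EuclideanSpace.single b₀' (1 : ℝ)) b₂| ≤
        C * (((supDist b₁.src b₂.src : ℕ) : ℝ) / (L : ℝ) ^ j) ^ α * Real.exp (-(δ * (1 - α) * torusSupNorm (Mk (⟨d + 1, L, m, K, hd, hL⟩ : Params) j)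
            (rep (Mk (⟨d + 1, L, m, K, hd, hL⟩ : Params) j) (iterBlockOf j b₁.src) - rep (Mk (⟨d + 1, L, m, K, hd, hL⟩ : Params) j) y))) := by
  obtain ⟨δG, hδG, CG, hCG, hG⟩ := blockBound_GE_scaling d L hd hL one_pos
  obtain ⟨δD, hδD, HD⟩ := holderBound_DGE_scaling d L hd hL one_pos
  set κH : ℝ := kappa163 (d + 1) / ((d : ℝ) + 1) with hκH
  have hκH0 : 0 < κH := div_pos (kappa163_pos _) (by positivity)
  -- rates: `Q_jG` at `δ₁ = min(δ_G, κ_H/2)`; everything at `δ(1−α)`, `δ = min(min(δ_G, κ_H/4), δ_D)` (`α`-free)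
  set δ₁ : ℝ := min δG (κH / 2) with hδ₁
  have hδ₁0 : 0 < δ₁ := lt_min hδG (half_pos hκH0)
  have hδ₁G : δ₁ ≤ δG := min_le_left _ _
  have hδ₁H : δ₁ < κH := lt_of_le_of_lt (min_le_right _ _) (half_lt_self hκH0)
  set δ : ℝ := min (min δG (κH / 4)) δD with hδ
  have hδ0 : 0 < δ := lt_min (lt_min hδG (by linarith)) hδD
  have hδδ₁ : δ ≤ δ₁ := (min_le_left _ _).trans (le_min (min_le_left _ _) ((min_le_right _ _).trans (by linarith)))
  have hδH : δ ≤ κH / 4 := (min_le_left _ _).trans (min_le_right _ _)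
  have hδD' : δ ≤ δD := min_le_right _ _
  set K₁ : ℝ := latticeConst (d + 1) (κH - δ₁) with hK₁
  have hK₁0 : 0 ≤ K₁ := latticeConst_nonneg _ (by linarith)
  have hL0 : 0 < L := by have := hL.2; omega
  haveI : NeZero L := ⟨by omega⟩
  have hLp : (0 : ℝ) < L := by exact_mod_cast hL0
  refine ⟨δ, hδ0, fun α hα0 hα1 => ?_⟩
  obtain ⟨CD, hCD, hDG⟩ := HD α hα0 hα1
  have h1α : 0 < 1 - α := by linarith
  have h1pα : 0 < 1 + α := by linarith
  have hpos : 0 < κH * (1 - α) := mul_pos hκH0 h1α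
  have hδ'0 : 0 ≤ δ * (1 - α) := by positivity
  have hδ'1 : δ * (1 - α) ≤ δ := mul_le_of_le_one_right hδ0.le (by linarith)
  have hδ'b : δ * (1 - α) ≤ δ₁ := hδ'1.trans hδδ₁
  have hδ'D : δ * (1 - α) ≤ δD := hδ'1.trans hδD'
  have hδ'a : δ * (1 - α) < κH * ((1 - α) / (1 + α)) := by
    rw [← mul_div_assoc, lt_div_iff₀ h1pα]
    calc δ * (1 - α) * (1 + α) ≤ κH / 4 * (1 - α) * (1 + α) :=
          mul_le_mul_of_nonneg_right (mul_le_mul_of_nonneg_right hδH h1α.le) h1pα.le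
      _ = κH * (1 - α) * ((1 + α) / 4) := by ring
      _ < κH * (1 - α) * 1 := mul_lt_mul_of_pos_left (by linarith) hpos
      _ = κH * (1 - α) := mul_one _
  have hCHD : 0 ≤ CHD d α := CHD_nonneg (d := d) hα0 hα1
  set K₂ : ℝ := latticeConst (d + 1) (κH * ((1 - α) / (1 + α)) - δ * (1 - α)) with hK₂
  have hK₂0 : 0 ≤ K₂ := latticeConst_nonneg _ (by linarith)
  set AD : ℝ := CHD d α * ((d + 1 : ℕ) : ℝ) * Real.exp κH * ((1 * (d + 1) : ℕ) : ℝ) with hAD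
  have hAD0 : 0 ≤ AD := by positivity
  set C : ℝ := CD + AD * (Real.exp κH * CG * K₁) * K₂ with hC
  have hC0 : 0 ≤ C := by positivity
  refine ⟨C, hC0, ?_⟩
  intro m K j hc hj Λ' w hw lam b₁ b₂ hdir hle y
  have hj' : j ≤ m + K := Nat.le_of_succ_le hj
  have hLj : (0 : ℝ) < (L : ℝ) ^ j := by positivity
  have hw' : (0 : ℝ) < 1 * ((L : ℝ) ^ j) ^ (d + 1) := by positivity
  have ht0 : 0 ≤ (((supDist b₁.src b₂.src : ℕ) : ℝ) / (L : ℝ) ^ j) ^ α := Real.rpow_nonneg (by positivity) _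
  have hρ : IsPseudoDist (fun t t' : Site (⟨d + 1, L, m, K, hd, hL⟩ : Params) j => torusSupNorm (Mk (⟨d + 1, L, m, K, hd, hL⟩ : Params) j) (rep (Mk (⟨d + 1, L, m, K, hd, hL⟩ : Params) j) t - rep (Mk (⟨d + 1, L, m, K, hd, hL⟩ : Params) j) t')) := torusDist_isPseudoDist (Mk (⟨d + 1, L, m, K, hd, hL⟩ : Params) j)
  have hK : SumBound (fun t t' : Site (⟨d + 1, L, m, K, hd, hL⟩ : Params) j => torusSupNorm (Mk (⟨d + 1, L, m, K, hd, hL⟩ : Params) j) (rep (Mk (⟨d + 1, L, m, K, hd, hL⟩ : Params) j) t - rep (Mk (⟨d + 1, L, m, K, hd, hL⟩ : Params) j) t')) (fun a => latticeConst (d + 1) a) := torusDist_sumBound (Mk (⟨d + 1, L, m, K, hd, hL⟩ : Params) j)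
  have hGb := hG m K j hj' hc hw'
  have hQ := blockBound_Qv hc hj' Λ' w hκH0.le
  -- `Q_jG` at rate `δ₁` (block bound, p22 files 2, 6)
  have h1 := blockBound_comp hρ hK (tsV1 hc Λ' w).Qv (GE (Domains.whole (P := (⟨d + 1, L, m, K, hd, hL⟩ : Params)) j hj') hc (w := fun _ => 1 * ((L : ℝ) ^ j) ^ (d + 1)) (fun _ => hw'))
    (fun b : PBond (⟨d + 1, L, m, K, hd, hL⟩ : Params) j => b.src) (fun b₀ : PBond (⟨d + 1, L, m, K, hd, hL⟩ : Params) 0 => iterBlockOf j b₀.src) (fun b₀ : PBond (⟨d + 1, L, m, K, hd, hL⟩ : Params) 0 => iterBlockOf j b₀.src)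
    (Cf := Real.exp κH) (Cg := CG) (by positivity) hCG hδ₁0.le hδ₁G hδ₁H hQ hGb
  -- `(D_λH_j)(Q_jG)`: pair bound at rate `δ(1−α)` (file 1's `holderBound_comp`, first factor file 3)
  have h2 := holderBound_comp hρ hK (((((L : ℝ) ^ j) • (onE (LinearMap.funLeft ℝ ℝ (fun b : PBond (⟨d + 1, L, m, K, hd, hL⟩ : Params) 0 =>
              (⟨b.src.shift lam, b.dir⟩ : PBond (⟨d + 1, L, m, K, hd, hL⟩ : Params) 0))) - LinearMap.id) :
          BondSpace (⟨d + 1, L, m, K, hd, hL⟩ : Params) →ₗ[ℝ] BondSpace (⟨d + 1, L, m, K, hd, hL⟩ : Params))) ∘ₗ (tsV1 hc Λ' w).Hj) ((tsV1 hc Λ' w).Qv ∘ₗ GE (Domains.whole (P := (⟨d + 1, L, m, K, hd, hL⟩ : Params)) j hj') hc (w := fun _ => 1 * ((L : ℝ) ^ j) ^ (d + 1)) (fun _ => hw'))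
    (fun b : PBond (⟨d + 1, L, m, K, hd, hL⟩ : Params) j => b.src) (fun b₀ : PBond (⟨d + 1, L, m, K, hd, hL⟩ : Params) 0 => iterBlockOf j b₀.src) b₁ b₂ (iterBlockOf j b₁.src)
    (Cf := CHD d α * ((d + 1 : ℕ) : ℝ) * Real.exp κH * (((supDist b₁.src b₂.src : ℕ) : ℝ) / (L : ℝ) ^ j) ^ α * ((1 * (d + 1) : ℕ) : ℝ)) (Cg := Real.exp κH * CG * K₁)
    (by positivity) (by positivity) hδ'0 hδ'b hδ'a (fun y' => holderBound_DHj hc hj Λ' hw hα0 hα1 lam b₁ b₂ hdir hle y') h1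
  -- `D_λG^{(n^{d+1})}` and `(D_λH_j)(Q_jG)` at the common rate `δ(1−α)`
  have h3 := holderBound_mono hρ (((((L : ℝ) ^ j) • (onE (LinearMap.funLeft ℝ ℝ (fun b : PBond (⟨d + 1, L, m, K, hd, hL⟩ : Params) 0 =>
              (⟨b.src.shift lam, b.dir⟩ : PBond (⟨d + 1, L, m, K, hd, hL⟩ : Params) 0))) - LinearMap.id) :
          BondSpace (⟨d + 1, L, m, K, hd, hL⟩ : Params) →ₗ[ℝ] BondSpace (⟨d + 1, L, m, K, hd, hL⟩ : Params))) ∘ₗ GE (Domains.whole (P := (⟨d + 1, L, m, K, hd, hL⟩ : Params)) j hj') hc (w := fun _ => 1 * ((L : ℝ) ^ j) ^ (d + 1)) (fun _ => hw'))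
    (fun b₀ : PBond (⟨d + 1, L, m, K, hd, hL⟩ : Params) 0 => iterBlockOf j b₀.src) b₁ b₂ (iterBlockOf j b₁.src) (C' := CD * (((supDist b₁.src b₂.src : ℕ) : ℝ) / (L : ℝ) ^ j) ^ α)
    (by positivity) le_rfl hδ'D (hDG m K j hj' hc hw' lam b₁ b₂ hdir hle)
  have h4 := holderBound_mono hρ ((((((L : ℝ) ^ j) • (onE (LinearMap.funLeft ℝ ℝ (fun b : PBond (⟨d + 1, L, m, K, hd, hL⟩ : Params) 0 =>
              (⟨b.src.shift lam, b.dir⟩ : PBond (⟨d + 1, L, m, K, hd, hL⟩ : Params) 0))) - LinearMap.id) :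
          BondSpace (⟨d + 1, L, m, K, hd, hL⟩ : Params) →ₗ[ℝ] BondSpace (⟨d + 1, L, m, K, hd, hL⟩ : Params))) ∘ₗ (tsV1 hc Λ' w).Hj) ∘ₗ ((tsV1 hc Λ' w).Qv ∘ₗ GE (Domains.whole (P := (⟨d + 1, L, m, K, hd, hL⟩ : Params)) j hj') hc (w := fun _ => 1 * ((L : ℝ) ^ j) ^ (d + 1)) (fun _ => hw')))
    (fun b₀ : PBond (⟨d + 1, L, m, K, hd, hL⟩ : Params) 0 => iterBlockOf j b₀.src) b₁ b₂ (iterBlockOf j b₁.src)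
    (C' := CHD d α * ((d + 1 : ℕ) : ℝ) * Real.exp κH * (((supDist b₁.src b₂.src : ℕ) : ℝ) / (L : ℝ) ^ j) ^ α * ((1 * (d + 1) : ℕ) : ℝ) * (Real.exp κH * CG * K₁) * K₂)
    (by positivity) (le_of_eq (by rw [hK₂])) le_rfl h2
  -- `D_λG̃_j = D_λG^{(n^{d+1})} − (D_λH_j)(Q_jG^{(n^{d+1})})`
  have hGt : ((((L : ℝ) ^ j) • (onE (LinearMap.funLeft ℝ ℝ (fun b : PBond (⟨d + 1, L, m, K, hd, hL⟩ : Params) 0 =>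
              (⟨b.src.shift lam, b.dir⟩ : PBond (⟨d + 1, L, m, K, hd, hL⟩ : Params) 0))) - LinearMap.id) :
          BondSpace (⟨d + 1, L, m, K, hd, hL⟩ : Params) →ₗ[ℝ] BondSpace (⟨d + 1, L, m, K, hd, hL⟩ : Params))) ∘ₗ (tsV1 hc Λ' w).Gt =
      ((((L : ℝ) ^ j) • (onE (LinearMap.funLeft ℝ ℝ (fun b : PBond (⟨d + 1, L, m, K, hd, hL⟩ : Params) 0 =>
              (⟨b.src.shift lam, b.dir⟩ : PBond (⟨d + 1, L, m, K, hd, hL⟩ : Params) 0))) - LinearMap.id) :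
          BondSpace (⟨d + 1, L, m, K, hd, hL⟩ : Params) →ₗ[ℝ] BondSpace (⟨d + 1, L, m, K, hd, hL⟩ : Params))) ∘ₗ GE (Domains.whole (P := (⟨d + 1, L, m, K, hd, hL⟩ : Params)) j hj') hc (w := fun _ => 1 * ((L : ℝ) ^ j) ^ (d + 1)) (fun _ => hw') -
        (((((L : ℝ) ^ j) • (onE (LinearMap.funLeft ℝ ℝ (fun b : PBond (⟨d + 1, L, m, K, hd, hL⟩ : Params) 0 =>
              (⟨b.src.shift lam, b.dir⟩ : PBond (⟨d + 1, L, m, K, hd, hL⟩ : Params) 0))) - LinearMap.id) :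
          BondSpace (⟨d + 1, L, m, K, hd, hL⟩ : Params) →ₗ[ℝ] BondSpace (⟨d + 1, L, m, K, hd, hL⟩ : Params))) ∘ₗ (tsV1 hc Λ' w).Hj) ∘ₗ ((tsV1 hc Λ' w).Qv ∘ₗ GE (Domains.whole (P := (⟨d + 1, L, m, K, hd, hL⟩ : Params)) j hj') hc (w := fun _ => 1 * ((L : ℝ) ^ j) ^ (d + 1)) (fun _ => hw')) := by
    rw [Gt_eq_comp_GE hc hj Λ' hw hw', LinearMap.sub_comp, LinearMap.id_comp, LinearMap.comp_sub, LinearMap.comp_assoc,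
      ← LinearMap.comp_assoc ((tsV1 hc Λ' w).Qv ∘ₗ GE (Domains.whole (P := (⟨d + 1, L, m, K, hd, hL⟩ : Params)) j hj') hc (w := fun _ => 1 * ((L : ℝ) ^ j) ^ (d + 1)) (fun _ => hw'))]
  rw [hGt]
  have h5 := holderBound_sub (ρ := (fun t t' : Site (⟨d + 1, L, m, K, hd, hL⟩ : Params) j => torusSupNorm (Mk (⟨d + 1, L, m, K, hd, hL⟩ : Params) j) (rep (Mk (⟨d + 1, L, m, K, hd, hL⟩ : Params) j) t - rep (Mk (⟨d + 1, L, m, K, hd, hL⟩ : Params) j) t'))) _ _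
    (fun b₀ : PBond (⟨d + 1, L, m, K, hd, hL⟩ : Params) 0 => iterBlockOf j b₀.src) b₁ b₂ (iterBlockOf j b₁.src) h3 h4 y
  refine h5.trans (le_of_eq ?_)
  rw [hC, hAD]
  ring

end Literature.MathematicalPhysics.QuantumFieldTheory.Balaban1983to89.B6BlockHolderCompositesV1

end
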